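/-
Copyright (c) 2026. All rights reserved.
Released under Apache 2.0 license as described in the file LICENSE.
-/
import Summits.NavierStokesRegularity.FunctionalMining.StretchingLaminateStep
import Summits.NavierStokesRegularity.FunctionalMining.StretchingConfinementErrors
import Mathlib.Tactic.Linarith
import HarnessLib

/-!
# Segment algebra for the local realization step `LaminateStep` (dict (ah))

Honest framing: search for candidate a priori estimates; no regularity claim. Pure matrix algebra over
`Fin 3 → Fin 3 → ℝ` plus two bookkeeping integrals, supporting the hand blueprint
`pub-nsfunc-dict/StretchingLaminateStep.BLUEPRINT.md` (§2 Lemma V, §3 Step 2/Step 4) for the node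
`LaminateStep` of `StretchingLaminateStep.lean` ((ag)):

* `vortSqM_segment`, `vortSqM_segment_le` — `|ω|²` is a convex quadratic along matrix segments:
  `|ω(Y + θX)|² ≤ max(|ω(Y)|², |ω(Y+X)|²)` for `θ ∈ [0,1]` (ramps and envelope transitions cost nothing);
  `vortSqM_layer_le` — the laminate version between the two children `G.layer (−λ) s`, `G.layer (1−λ) s`;
* `prodBC_segment` — the cubic expansion `prodBC (Y + θX) = prodBC Y + θ·mix₁ Y X + θ²·mix₂ Y X + θ³·prodBC X`
  with `mix₁ Y X = ∑ᵢⱼ mix₁Coeff Y i j · Xᵢⱼ` LINEAR in `X` (so its fast average vanishes on mean-zero gradients);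
* `halfSqM_segment` — the quadratic expansion of `½|·|²_F` with the Frobenius pairing `frob`;
* `integral_mix₁`, `integral_frob` — the integrals of the linear terms are the linear terms of the integrals;
  `integral_gradAt_curlField_eq_zero` — every entry of `∇(curl A)` has mean zero on `T³`.

Nothing here is deep; it is staged so that the prover's `LaminateStep` file can cite the identities by name.
-/

noncomputable section

open MeasureTheory

namespace Summit.NavierStokesRegularity.FunctionalMining

open Literature.Analysis Literature.Analysis.FunctionSpaces Literature.Analysis.FunctionSpaces.Torus
open Literature.Analysis.FluidPDE Literature.Analysis.FluidPDE.Torus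

namespace Laminate

open WrapStretching Confinement

/-! ## 1. `|ω|²` along segments -/

/-- `|ω|²` is nonnegative. [ours; bookkeeping] -/
theorem vortSqM_nonneg' (X : Fin 3 → Fin 3 → ℝ) : 0 ≤ vortSqM X := by
  unfold vortSqM; positivity

/-- **Segment identity for `|ω|²`**: `|ω(Y+θX)|² = (1−θ)|ω(Y)|² + θ|ω(Y+X)|² − θ(1−θ)|ω(X)|²`. [ours; elementary] -/
theorem vortSqM_segment (Y X : Fin 3 → Fin 3 → ℝ) (θ : ℝ) :
    vortSqM (Y + θ • X) = (1 - θ) * vortSqM Y + θ * vortSqM (Y + X) - θ * (1 - θ) * vortSqM X := by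
  simp only [vortSqM, Pi.add_apply, Pi.smul_apply, smul_eq_mul]
  ring

/-- **Lemma V (convexity of `|ω|²` along segments)**: for `θ ∈ [0,1]`,
`|ω(Y + θX)|² ≤ max (|ω(Y)|², |ω(Y+X)|²)`. [ours; elementary] -/
theorem vortSqM_segment_le (Y X : Fin 3 → Fin 3 → ℝ) {θ : ℝ} (h0 : 0 ≤ θ) (h1 : θ ≤ 1) :
    vortSqM (Y + θ • X) ≤ max (vortSqM Y) (vortSqM (Y + X)) := by
  rw [vortSqM_segment]
  have hX := vortSqM_nonneg' X
  have hA : vortSqM Y ≤ max (vortSqM Y) (vortSqM (Y + X)) := le_max_left _ _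
  have hB : vortSqM (Y + X) ≤ max (vortSqM Y) (vortSqM (Y + X)) := le_max_right _ _
  nlinarith [mul_nonneg (sub_nonneg.mpr h1) (sub_nonneg.mpr hA), mul_nonneg h0 (sub_nonneg.mpr hB),
    mul_nonneg (mul_nonneg h0 (sub_nonneg.mpr h1)) hX]

/-- Convex-combination form: `|ω(P + θ(Q−P))|² ≤ max(|ω(P)|², |ω(Q)|²)` for `θ ∈ [0,1]`. [ours; elementary] -/
theorem vortSqM_convexComb_le (P Q : Fin 3 → Fin 3 → ℝ) {θ : ℝ} (h0 : 0 ≤ θ) (h1 : θ ≤ 1) :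
    vortSqM (P + θ • (Q - P)) ≤ max (vortSqM P) (vortSqM Q) := by
  have h := vortSqM_segment_le P (Q - P) h0 h1
  rwa [add_sub_cancel] at h

/-- The rank-one matrix `c ⊗ n` of a split, as a real matrix. [ours; bookkeeping] -/
def Split.outerM (s : Split) : Fin 3 → Fin 3 → ℝ :=
  ![![(s.c0 : ℝ) * s.n0, (s.c0 : ℝ) * s.n1, (s.c0 : ℝ) * s.n2],
    ![(s.c1 : ℝ) * s.n0, (s.c1 : ℝ) * s.n1, (s.c1 : ℝ) * s.n2],
    ![(s.c2 : ℝ) * s.n0, (s.c2 : ℝ) * s.n1, (s.c2 : ℝ) * s.n2]]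

/-- Cast of a layered gradient: `(G.layer t s).toMat = G.toMat + t • (c ⊗ n)`. [ours; bookkeeping] -/
theorem toMat_layer (G : Grad) (t : ℚ) (s : Split) :
    (G.layer t s).toMat = G.toMat + ((t : ℝ)) • s.outerM := by
  ext i j
  fin_cases i <;> fin_cases j <;>
    simp [Grad.toMat, Grad.layer, Split.outerM, Matrix.cons_val_zero, Matrix.cons_val_one] <;> ring

/-- The two children differ by `c ⊗ n`: `G₊.toMat − G₋.toMat = c ⊗ n`. [ours; bookkeeping] -/
theorem toMat_layer_sub (G : Grad) (s : Split) :
    (G.layer (1 - s.lam) s).toMat - (G.layer (-s.lam) s).toMat = s.outerM := by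
  rw [toMat_layer, toMat_layer]
  ext i j
  simp only [Pi.sub_apply, Pi.add_apply, Pi.smul_apply, smul_eq_mul]
  push_cast
  ring

/-- **Laminate ramps cost nothing**: for a REAL parameter `τ ∈ [−λ, 1−λ]` the intermediate gradient
`G + τ·c⊗n` has `|ω|² ≤ max(|ω(G₋)|², |ω(G₊)|²)`. [ours; elementary] -/
theorem vortSqM_layer_le (G : Grad) (s : Split) {τ : ℝ} (h0 : -(s.lam : ℝ) ≤ τ) (h1 : τ ≤ 1 - (s.lam : ℝ)) :
    vortSqM (G.toMat + τ • s.outerM) ≤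
      max (vortSqM (G.layer (-s.lam) s).toMat) (vortSqM (G.layer (1 - s.lam) s).toMat) := by
  have hθ0 : 0 ≤ τ + s.lam := by linarith
  have hθ1 : τ + s.lam ≤ 1 := by linarith
  have key : G.toMat + τ • s.outerM =
      (G.layer (-s.lam) s).toMat + (τ + s.lam) • ((G.layer (1 - s.lam) s).toMat - (G.layer (-s.lam) s).toMat) := by
    rw [toMat_layer_sub, toMat_layer]
    ext i j
    simp only [Pi.add_apply, Pi.smul_apply, smul_eq_mul]
    push_cast
    ring
  rw [key]
  exact vortSqM_convexComb_le _ _ hθ0 hθ1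

/-- Remainder form of Lemma V on a plateau: if `|ω(Y)|² ≤ B` and `|ω(Y + X)|² ≤ B` then
`|ω(Y + θX)|² ≤ B` for `θ ∈ [0,1]`. [ours; elementary] -/
theorem vortSqM_segment_le_of_le {Y X : Fin 3 → Fin 3 → ℝ} {θ B : ℝ} (h0 : 0 ≤ θ) (h1 : θ ≤ 1)
    (hY : vortSqM Y ≤ B) (hYX : vortSqM (Y + X) ≤ B) : vortSqM (Y + θ • X) ≤ B :=
  (vortSqM_segment_le Y X h0 h1).trans (max_le hY hYX)

/-! ## 2. The cubic expansion of `prodBC` -/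

/-- The trilinear form behind `prodBC`: `∑ A_ij B_jk C_ki − ∑ₘᵢ A_im ∑ⱼ B_jm C_ji`. [ours; bookkeeping] -/
def triBC (A B C : Fin 3 → Fin 3 → ℝ) : ℝ :=
  (∑ i, ∑ j, ∑ k, A i j * B j k * C k i) - ∑ m, ∑ i, A i m * ∑ j, B j m * C j i

/-- `prodBC X = triBC X X X`. [ours; bookkeeping] -/
theorem prodBC_eq_triBC (X : Fin 3 → Fin 3 → ℝ) : prodBC X = triBC X X X := rfl

/-- The part of `prodBC (Y + X)` that is quadratic in `Y` and LINEAR in `X`. [ours; bookkeeping] -/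
def mix₁ (Y X : Fin 3 → Fin 3 → ℝ) : ℝ := triBC Y Y X + triBC Y X Y + triBC X Y Y

/-- The part of `prodBC (Y + X)` that is linear in `Y` and quadratic in `X`. [ours; bookkeeping] -/
def mix₂ (Y X : Fin 3 → Fin 3 → ℝ) : ℝ := triBC Y X X + triBC X Y X + triBC X X Y

/-- **Cubic expansion along a segment**:
`prodBC (Y + θX) = prodBC Y + θ·mix₁ Y X + θ²·mix₂ Y X + θ³·prodBC X`. [ours; elementary] -/
theorem prodBC_segment (Y X : Fin 3 → Fin 3 → ℝ) (θ : ℝ) :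
    prodBC (Y + θ • X) = prodBC Y + θ * mix₁ Y X + θ ^ 2 * mix₂ Y X + θ ^ 3 * prodBC X := by
  simp only [prodBC, mix₁, mix₂, triBC, Fin.sum_univ_three, Pi.add_apply, Pi.smul_apply, smul_eq_mul]
  ring

/-- `prodBC (Y + X) = prodBC Y + mix₁ Y X + mix₂ Y X + prodBC X`. [ours; elementary] -/
theorem prodBC_add (Y X : Fin 3 → Fin 3 → ℝ) :
    prodBC (Y + X) = prodBC Y + mix₁ Y X + mix₂ Y X + prodBC X := by
  have h := prodBC_segment Y X 1
  simp only [one_smul, one_mul, one_pow] at h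
  exact h

/-- Explicit coefficients of the linear form `X ↦ mix₁ Y X`:
`3(Y²)ⱼᵢ − (YYᵀ)ⱼᵢ − (Y²)ᵢⱼ − (YᵀY)ᵢⱼ`. [ours; bookkeeping] -/
def mix₁Coeff (Y : Fin 3 → Fin 3 → ℝ) (i j : Fin 3) : ℝ :=
  3 * (∑ k, Y j k * Y k i) - (∑ m, Y j m * Y i m) - (∑ k, Y i k * Y k j) - ∑ k, Y k i * Y k j

/-- **`mix₁` is linear in `X` with coefficients `mix₁Coeff Y`.** [ours; elementary] -/
theorem mix₁_eq_sum (Y X : Fin 3 → Fin 3 → ℝ) : mix₁ Y X = ∑ i, ∑ j, mix₁Coeff Y i j * X i j := by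
  simp only [mix₁, triBC, mix₁Coeff, Fin.sum_univ_three]
  ring

/-- `mix₁ Y 0 = 0`. [ours; bookkeeping] -/
theorem mix₁_zero (Y : Fin 3 → Fin 3 → ℝ) : mix₁ Y 0 = 0 := by
  simp [mix₁_eq_sum]

/-! ## 3. The quadratic expansion of `½|·|²_F` -/

/-- Frobenius pairing `∑ᵢⱼ Yᵢⱼ Xᵢⱼ`. [ours; bookkeeping] -/
def frob (Y X : Fin 3 → Fin 3 → ℝ) : ℝ := ∑ i, ∑ j, Y i j * X i j

/-- **Quadratic expansion**: `halfSqM (Y + θX) = halfSqM Y + θ·frob Y X + θ²·halfSqM X`. [ours; elementary] -/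
theorem halfSqM_segment (Y X : Fin 3 → Fin 3 → ℝ) (θ : ℝ) :
    halfSqM (Y + θ • X) = halfSqM Y + θ * frob Y X + θ ^ 2 * halfSqM X := by
  simp only [halfSqM, frob, Fin.sum_univ_three, Pi.add_apply, Pi.smul_apply, smul_eq_mul]
  ring

/-- `halfSqM (Y + X) = halfSqM Y + frob Y X + halfSqM X`. [ours; elementary] -/
theorem halfSqM_add (Y X : Fin 3 → Fin 3 → ℝ) : halfSqM (Y + X) = halfSqM Y + frob Y X + halfSqM X := by
  have h := halfSqM_segment Y X 1
  simp only [one_smul, one_mul, one_pow] at h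
  exact h

/-- `halfSqM` is nonnegative. [ours; bookkeeping] -/
theorem halfSqM_nonneg (X : Fin 3 → Fin 3 → ℝ) : 0 ≤ halfSqM X := by
  unfold halfSqM; positivity

/-! ## 4. Integrals of the linear terms -/

/-- **The integral of `mix₁ Y (X x)` is `mix₁` of the entrywise integrals.** [ours; bookkeeping] -/
theorem integral_mix₁ (Y : Fin 3 → Fin 3 → ℝ) {X : UnitAddTorus (Fin 3) → Fin 3 → Fin 3 → ℝ}
    (hX : ∀ i j, Integrable fun x => X x i j) :
    ∫ x, mix₁ Y (X x) = ∑ i, ∑ j, mix₁Coeff Y i j * ∫ x, X x i j := by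
  simp_rw [mix₁_eq_sum]
  rw [integral_finsetSum _ fun i _ => integrable_finsetSum _ fun j _ => (hX i j).const_mul _]
  refine Finset.sum_congr rfl fun i _ => ?_
  rw [integral_finsetSum _ fun j _ => (hX i j).const_mul _]
  refine Finset.sum_congr rfl fun j _ => ?_
  exact integral_const_mul _ _

/-- If every entry of `X` has mean zero then `∫ mix₁ Y (X x) = 0`. [ours; bookkeeping] -/
theorem integral_mix₁_eq_zero (Y : Fin 3 → Fin 3 → ℝ) {X : UnitAddTorus (Fin 3) → Fin 3 → Fin 3 → ℝ}
    (hX : ∀ i j, Integrable fun x => X x i j) (h0 : ∀ i j, ∫ x, X x i j = 0) : ∫ x, mix₁ Y (X x) = 0 := by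
  rw [integral_mix₁ Y hX]
  simp [h0]

/-- **The integral of `frob Y (X x)` is `frob` of the entrywise integrals.** [ours; bookkeeping] -/
theorem integral_frob (Y : Fin 3 → Fin 3 → ℝ) {X : UnitAddTorus (Fin 3) → Fin 3 → Fin 3 → ℝ}
    (hX : ∀ i j, Integrable fun x => X x i j) :
    ∫ x, frob Y (X x) = ∑ i, ∑ j, Y i j * ∫ x, X x i j := by
  unfold frob
  rw [integral_finsetSum _ fun i _ => integrable_finsetSum _ fun j _ => (hX i j).const_mul _]
  refine Finset.sum_congr rfl fun i _ => ?_
  rw [integral_finsetSum _ fun j _ => (hX i j).const_mul _]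
  refine Finset.sum_congr rfl fun j _ => ?_
  exact integral_const_mul _ _

/-- If every entry of `X` has mean zero then `∫ frob Y (X x) = 0`. [ours; bookkeeping] -/
theorem integral_frob_eq_zero (Y : Fin 3 → Fin 3 → ℝ) {X : UnitAddTorus (Fin 3) → Fin 3 → Fin 3 → ℝ}
    (hX : ∀ i j, Integrable fun x => X x i j) (h0 : ∀ i j, ∫ x, X x i j = 0) : ∫ x, frob Y (X x) = 0 := by
  rw [integral_frob Y hX]
  simp [h0]

/-- **Every entry of `∇(curl A)` has mean zero on `T³`** (integral of a partial derivative of a smooth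
periodic function; Literature `Torus.integral_partialDeriv_eq_zero_holds`). [folklore] -/
theorem integral_gradAt_curlField_eq_zero {A : UnitAddTorus (Fin 3) → EuclideanSpace ℝ (Fin 3)}
    (hA : Torus.IsSmooth A) (i j : Fin 3) : ∫ x, gradAt (curlField A) x i j = 0 := by
  have hF : Torus.IsSmooth (curlField A) := isSmooth_curlField hA
  have hint : Integrable fun x => Torus.partialDeriv j (curlField A) x := (hF.partialDeriv j).integrable
  have h0 : ∫ x, Torus.partialDeriv j (curlField A) x = 0 := Torus.integral_partialDeriv_eq_zero_holds hF j
  have h1 : (fun x => gradAt (curlField A) x i j) =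
      fun x => (EuclideanSpace.proj i : EuclideanSpace ℝ (Fin 3) →L[ℝ] ℝ) (Torus.partialDeriv j (curlField A) x) := by
    funext x; rfl
  rw [h1, ContinuousLinearMap.integral_comp_comm _ hint, h0, map_zero]

/-- Entries of `∇(curl A)` are integrable (smooth on a compact torus). [folklore] -/
theorem integrable_gradAt_curlField {A : UnitAddTorus (Fin 3) → EuclideanSpace ℝ (Fin 3)}
    (hA : Torus.IsSmooth A) (i j : Fin 3) : Integrable fun x => gradAt (curlField A) x i j :=
  (Confinement.isSmooth_gradAt (isSmooth_curlField hA) i j).integrable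

end Laminate

end Summit.NavierStokesRegularity.FunctionalMining

end
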